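import Summits.RiemannHypothesis.RiemannHypothesis.Theorems.WeilArchPanelsN109ENe109v1D
import HarnessLib

/-!
# G3 A-layer data: panel certificates — window vector `ne109v1` (`v(x) = P(x/b)`, b = 109/100, 40 panels)

Generated by `cert/abgen/panels.py` (prover A g12 cellgen; run by prover A g25 (A g24 kit) for the SHARP parity-ladder U-side (kernel scale 2^140, Kφ 64, 45-digit panel polynomials, exact per-panel budgets) at b = 109/100; dyadic penalty polynomial in `y = x/b`).
Kernel-checked by `decide +kernel`, each theorem a few seconds. [folklore]
-/

set_option linter.dupNamespace false

namespace Summit.RiemannHypothesis.RiemannHypothesis.Theorems.EvenWinsBeyondArch.ArchN109E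

open Literature.NumberTheory.LFunctions Literature.Analysis.ValidatedNumerics.PolyMP Literature.Analysis.ValidatedNumerics.NumericsMP Literature.Analysis.ValidatedNumerics.ExpPoly

set_option maxHeartbeats 0 in
/-- panel 15. [folklore] -/
theorem ne109v1_pc15 : archPanelCheck 1393796574908163946345982392040522594123776 (1 / 40) 22 14 64 5 20 4 15 (ne109v1Qs.getD 15 []) 1024 (ne109v1ps.getD 15 []) ne109v1E (((109 : ℚ)/100)) (ne109v1Ilo.getD 15 0) (ne109v1Ihi.getD 15 0) = true := by decide +kernel

set_option maxHeartbeats 0 in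
/-- panel 16. [folklore] -/
theorem ne109v1_pc16 : archPanelCheck 1393796574908163946345982392040522594123776 (1 / 40) 22 14 64 5 20 4 16 (ne109v1Qs.getD 16 []) 1024 (ne109v1ps.getD 16 []) ne109v1E (((109 : ℚ)/100)) (ne109v1Ilo.getD 16 0) (ne109v1Ihi.getD 16 0) = true := by decide +kernel

set_option maxHeartbeats 0 in
/-- panel 17. [folklore] -/
theorem ne109v1_pc17 : archPanelCheck 1393796574908163946345982392040522594123776 (1 / 40) 22 14 64 5 20 4 17 (ne109v1Qs.getD 17 []) 1024 (ne109v1ps.getD 17 []) ne109v1E (((109 : ℚ)/100)) (ne109v1Ilo.getD 17 0) (ne109v1Ihi.getD 17 0) = true := by decide +kernel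

set_option maxHeartbeats 0 in
/-- panel 18. [folklore] -/
theorem ne109v1_pc18 : archPanelCheck 1393796574908163946345982392040522594123776 (1 / 40) 22 14 64 5 20 4 18 (ne109v1Qs.getD 18 []) 1024 (ne109v1ps.getD 18 []) ne109v1E (((109 : ℚ)/100)) (ne109v1Ilo.getD 18 0) (ne109v1Ihi.getD 18 0) = true := by decide +kernel

set_option maxHeartbeats 0 in
/-- panel 19. [folklore] -/
theorem ne109v1_pc19 : archPanelCheck 1393796574908163946345982392040522594123776 (1 / 40) 22 14 64 5 20 4 19 (ne109v1Qs.getD 19 []) 1024 (ne109v1ps.getD 19 []) ne109v1E (((109 : ℚ)/100)) (ne109v1Ilo.getD 19 0) (ne109v1Ihi.getD 19 0) = true := by decide +kernel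

end Summit.RiemannHypothesis.RiemannHypothesis.Theorems.EvenWinsBeyondArch.ArchN109E
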